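import Literature.MathematicalPhysics.QuantumLattice.FermionLocalHamiltonianCovariance
import Literature.MathematicalPhysics.QuantumLattice.TIStateMeanEntropy
import HarnessLib

/-!
# The free-boundary partition function of a box tiled by sub-boxes, for every translation-invariant finite-range fermion interaction:
# `|log Z_{[0,km)^d} − k^d·log Z_{[0,m)^d} − β(k^d − 1)·Re(Ψ∅)_{∅∅}| ≤ β · k^d · |collar_R([0,m)^d)| · S_Ψ`

Topic `Literature/MathematicalPhysics/QuantumLattice` (family `hubbard`; crew hubbard-fast S2 «T > 0 / families of models»). The finite-volume
heart of the existence of the THERMODYNAMIC LIMIT OF THE FREE-BOUNDARY PRESSURE (Bratteli–Robinson II §6.2.4 / Simon §II.2) for a general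
Hermitian, even, translation-covariant interaction `Ψ` of finite range `R` on `ℤ^d`: the big box `[0,km)^d` is the disjoint union of the
`k^d` translates `m·j + [0,m)^d`; its local Hamiltonian is the DECOUPLED sum of the translated sub-box Hamiltonians plus the STRADDLING terms
(and a scalar correction from the empty-set term counted `k^d` times), the straddling terms have norm `≤ k^d·|thicken_R([0,m)^d) ∖ [0,m)^d|·S_Ψ`,
the decoupled partition function factorises (`FermionLocalHamiltonianCovariance`, `LayeredSystemPartitionFunction`), and `log Z` is
`β‖·‖`-Lipschitz in the Hamiltonian:

* §1 combinatorics: a sum over the subsets of a region partitioned into parts splits into the empty set, the non-empty subsets inside each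
  part, and the straddling subsets (`sum_powerset_eq_empty_add_parts_add_straddling`); sums over a covered set are bounded by the sum of the
  sums (`sum_le_sum_sum_of_subset_biUnion`); the sub-boxes `m·j + [0,m)^d` cover `[0,km)^d` (`exists_mem_subBox`).
* §2 **`localHamiltonian_box_eq_decoupled_add_straddling_sub`**: `H_{[0,km)^d} = Σ_j Γ H_{box_j} + W − (k^d − 1)·(Ψ∅)_{∅∅}·1`, and
  **`norm_straddling_le`**: `‖W‖ ≤ k^d·|collar|·S_Ψ`.
* §3 **`abs_log_partitionFn_box_sub_le`** (`β ≥ 0`): the displayed inequality; per volume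
  `|(km)^{-d} log Z_{[0,km)^d} − m^{-d} log Z_{[0,m)^d} − β(1 − k^{-d}) m^{-d} Re(Ψ∅)_{∅∅}| ≤ β·S_Ψ·|collar|/m^d` (`…_div_le`).

Everything is PROVED; no definition, no named fact, no number. (Next: the fill-in `[0,n)^d` vs `[0,km)^d` and the limit.)

## Mathlib / tree search

REUSED: `localHamiltonian_eq_sum`, `localHamiltonian_isHermitian`, `expect_empty_eq`-pattern (`𝔄_∅ = ℂ`), `HasFiniteRange.subset_thicken_singleton`,
`thicken_subset_thicken_of_subset`, `IsTranslationInvariant.sum_filter_not_subset_norm_le`, `norm_fermionEmbed_le`, `card_thicken_shiftSet_sdiff`,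
`log_partitionFn_decoupledSum_translates`, `abs_log_partitionFn_sub_log_partitionFn_le`, `log_partitionFn_add_smul_one`, `mem_shiftSet_smul_halfOpenBox`,
`shiftSet_smul_halfOpenBox_subset`, `disjoint_shiftSet_smul_halfOpenBox` (`TIStateMeanEntropy`), `card_halfOpenBox`; Mathlib `Finset.sum_biUnion`,
`Finset.sum_union_inter`, `Int.ediv_add_emod`, `Int.emod_nonneg`, `Int.emod_lt_of_pos`.

## References

* O. Bratteli, D. W. Robinson, *OAQSM 2* (1997), §6.2.4 (existence of the pressure; surface terms). [cite: BratteliRobinsonII1997, §6.2.4 (Prop. 6.2.39 ff.)]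
* O. Bratteli, A. Kishimoto, D. W. Robinson, Commun. Math. Phys. 64 (1978) 41, §3 (`W_Φ(Λ)` and its norm). [cite: BratteliKishimotoRobinson1978, Thm. 2 (proof, p. 48)]
-/

noncomputable section

open scoped ComplexOrder BigOperators Matrix.Norms.L2Operator
open Finset

namespace Literature.MathematicalPhysics.QuantumLattice

open Matrix HubbardWave0 Literature.Probability.LatticeModels ThermodynamicLimit

variable {d : ℕ}

/-! ### §1 Combinatorics of subsets of a partitioned region -/

section Combinatorics

variable {α : Type*} [DecidableEq α] {K : Type*} [Fintype K] {M : Type*} [AddCommGroup M]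

/-- **Splitting the subsets of a region along a family of pairwise disjoint parts** `P_j ⊆ Λ'`:
`Σ_{Y ⊆ Λ'} F Y = F ∅ + Σ_j (Σ_{Y ⊆ P_j} F Y − F ∅) + Σ_{Y ⊆ Λ', Y ≠ ∅, ∀ j, Y ⊄ P_j} F Y`.
[cite: BratteliKishimotoRobinson1978, §3 (H̃_Φ(Λ), W_Φ(Λ), p. 47)] -/
theorem sum_powerset_eq_empty_add_parts_add_straddling (Λ' : Finset α) (P : K → Finset α) (hP : ∀ j, P j ⊆ Λ')
    (hdisj : ∀ j j', j ≠ j' → Disjoint (P j) (P j')) (F : Finset α → M) :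
    ∑ Y ∈ Λ'.powerset, F Y =
      F ∅ + ∑ j, (∑ Y ∈ (P j).powerset, F Y - F ∅) +
        ∑ Y ∈ Λ'.powerset with (Y ≠ ∅ ∧ ∀ j, ¬ Y ⊆ P j), F Y := by
  classical
  -- the empty set
  rw [← Finset.sum_filter_add_sum_filter_not Λ'.powerset (fun Y => Y = ∅)]
  have h0 : ∑ Y ∈ Λ'.powerset with Y = ∅, F Y = F ∅ := by
    rw [Finset.sum_filter, Finset.sum_ite_eq' Λ'.powerset ∅ F, if_pos (Finset.empty_mem_powerset _)]
  rw [h0, add_assoc]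
  congr 1
  -- non-empty subsets: inside some part, or straddling
  rw [← Finset.sum_filter_add_sum_filter_not (Λ'.powerset.filter fun Y => ¬ Y = ∅) (fun Y => ∃ j, Y ⊆ P j),
    Finset.filter_filter, Finset.filter_filter]
  congr 1
  · -- the subsets inside some part: a disjoint union over the parts
    have hset : Λ'.powerset.filter (fun Y => ¬ Y = ∅ ∧ ∃ j, Y ⊆ P j) =
        Finset.univ.biUnion fun j => (P j).powerset.filter fun Y => ¬ Y = ∅ := by
      ext Y
      rw [Finset.mem_filter, Finset.mem_powerset, Finset.mem_biUnion]
      constructor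
      · rintro ⟨-, hne, j, hj⟩
        exact ⟨j, Finset.mem_univ _, Finset.mem_filter.2 ⟨Finset.mem_powerset.2 hj, hne⟩⟩
      · rintro ⟨j, -, hY⟩
        rw [Finset.mem_filter, Finset.mem_powerset] at hY
        exact ⟨hY.1.trans (hP j), hY.2, j, hY.1⟩
    have hpd : (↑(Finset.univ : Finset K) : Set K).PairwiseDisjoint fun j => (P j).powerset.filter fun Y => ¬ Y = ∅ := by
      intro j _ j' _ hjj'
      rw [Function.onFun, Finset.disjoint_left]
      intro Y hY hY'
      rw [Finset.mem_filter, Finset.mem_powerset] at hY hY'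
      obtain ⟨y, hy⟩ := Finset.nonempty_iff_ne_empty.2 hY.2
      exact Finset.disjoint_left.1 (hdisj j j' hjj') (hY.1 hy) (hY'.1 hy)
    rw [hset, Finset.sum_biUnion hpd]
    refine Finset.sum_congr rfl fun j _ => ?_
    rw [← Finset.sum_filter_add_sum_filter_not (P j).powerset (fun Y => Y = ∅)]
    have h0' : ∑ Y ∈ (P j).powerset with Y = ∅, F Y = F ∅ := by
      rw [Finset.sum_filter, Finset.sum_ite_eq' (P j).powerset ∅ F, if_pos (Finset.empty_mem_powerset _)]
    rw [h0']
    abel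
  · refine Finset.sum_congr ?_ fun _ _ => rfl
    ext Y
    simp only [Finset.mem_filter, not_exists]

/-- **A sum over a covered set is at most the sum of the sums** (non-negative summands). [cite: BratteliKishimotoRobinson1978, §3] -/
theorem sum_le_sum_sum_of_subset_biUnion {S : Finset (Finset α)} (T : K → Finset (Finset α)) (hS : S ⊆ Finset.univ.biUnion T)
    {f : Finset α → ℝ} (hf : ∀ Y, 0 ≤ f Y) : ∑ Y ∈ S, f Y ≤ ∑ j, ∑ Y ∈ T j, f Y := by
  classical
  refine (Finset.sum_le_sum_of_subset_of_nonneg hS fun _ _ _ => hf _).trans ?_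
  have key : ∀ s : Finset K, ∑ Y ∈ s.biUnion T, f Y ≤ ∑ j ∈ s, ∑ Y ∈ T j, f Y := by
    intro s
    induction s using Finset.induction_on with
    | empty => simp
    | insert a s ha ih =>
      rw [Finset.biUnion_insert, Finset.sum_insert ha]
      have hu := Finset.sum_union_inter (s₁ := T a) (s₂ := s.biUnion T) (f := f)
      have hi : 0 ≤ ∑ Y ∈ T a ∩ s.biUnion T, f Y := Finset.sum_nonneg fun _ _ => hf _
      linarith
  exact key _

end Combinatorics

/-! ### §1b The sub-boxes `m·j + [0,m)^d` cover `[0,km)^d` -/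

/-- **Every site of `[0,km)^d` lies in the sub-box `m·j + [0,m)^d` with `j = ⌊x/m⌋ ∈ [0,k)^d`** (`m ≥ 1`). [cite: FriedliVelenik2017, §3.2] -/
theorem exists_mem_subBox {m k : ℕ} (hm : 1 ≤ m) {x : Site d} (hx : x ∈ halfOpenBox d (k * m)) :
    ∃ j ∈ halfOpenBox d k, x ∈ shiftSet ((m : ℤ) • j) (halfOpenBox d m) := by
  have hm0 : (0 : ℤ) < m := by exact_mod_cast hm
  refine ⟨fun i => x i / m, ?_, ?_⟩
  · rw [mem_halfOpenBox] at hx ⊢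
    intro i
    obtain ⟨h0, hlt⟩ := hx i
    refine ⟨Int.ediv_nonneg h0 hm0.le, ?_⟩
    have h1 := Int.mul_ediv_add_emod (x i) m
    have h2 := Int.emod_nonneg (x i) hm0.ne'
    have hkm : ((k * m : ℕ) : ℤ) = (k : ℤ) * m := by push_cast; ring
    rw [hkm] at hlt
    by_contra hge
    push Not at hge
    have : (m : ℤ) * k ≤ m * (x i / m) := mul_le_mul_of_nonneg_left hge hm0.le
    linarith
  · rw [InfVolFermionState.mem_shiftSet_smul_halfOpenBox]
    intro i
    have h1 := Int.mul_ediv_add_emod (x i) m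
    have h2 := Int.emod_nonneg (x i) hm0.ne'
    have h3 := Int.emod_lt_of_pos (x i) hm0
    constructor <;> linarith

/-! ### §2 The box Hamiltonian: decoupled sub-boxes, straddling terms, and their norm -/

namespace FermionInteraction

variable {Ψ : FermionInteraction d} {R : ℝ}

/-- The empty-set term of the local Hamiltonian is the scalar `(Ψ∅)_{∅∅}·1`. [cite: BratteliRobinsonI1987, Def. 2.6.3 (𝔄_∅ = ℂ𝟙)] -/
theorem fermionEmbed_apply_empty (Ψ : FermionInteraction d) {Λ' : Finset (Site d)} (h : (∅ : Finset (Site d)) ⊆ Λ') :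
    fermionEmbed (PolySite.incl h) (Ψ.Φ ∅) = ((Ψ.Φ ∅) ∅ ∅) • (1 : FermionOp Λ') := by
  haveI : IsEmpty (Orb (PolySite (∅ : Finset (Site d)))) :=
    ⟨fun p => Finset.notMem_empty _ (mem_lexSites.1 (ofLex p).1.2)⟩
  have hA : Ψ.Φ ∅ = ((Ψ.Φ ∅) ∅ ∅) • (1 : FermionOp (∅ : Finset (Site d))) := by
    ext s t
    rw [Finset.eq_empty_of_isEmpty s, Finset.eq_empty_of_isEmpty t, Matrix.smul_apply, Matrix.one_apply_eq, smul_eq_mul, mul_one]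
  conv_lhs => rw [hA]
  rw [map_smul, map_one]

/-- The terms of `H_{Λ'}` inside a sub-region `P ⊆ Λ'` sum to the embedded `H_P`. [cite: BratteliKishimotoRobinson1978, §3 (H̃_Φ(Λ))] -/
theorem sum_powerset_subregion_eq (Ψ : FermionInteraction d) {P Λ' : Finset (Site d)} (hP : P ⊆ Λ') :
    ∑ Y ∈ P.powerset, (if h : Y ⊆ Λ' then fermionEmbed (PolySite.incl h) (Ψ.Φ Y) else 0) =
      fermionEmbed (PolySite.incl hP) (Ψ.localHamiltonian P) := by
  rw [Ψ.localHamiltonian_eq_sum P, map_sum]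
  refine Finset.sum_congr rfl fun Y hY => ?_
  rw [Finset.mem_powerset] at hY
  rw [dif_pos (hY.trans hP), dif_pos hY, fermionEmbed_fermionEmbed, PolySite.incl_trans]

variable {m k : ℕ}

/-- **THE BOX HAMILTONIAN OVER ITS SUB-BOXES**: with `box_j = m·j + [0,m)^d` (`j ∈ [0,k)^d`, `m ≥ 1`) and the straddling sum
`W = Σ_{Y ⊆ [0,km)^d, Y ≠ ∅, Y ⊄ every box_j} Γ Φ Y`:
`H_{[0,km)^d} = Σ_j Γ H_{box_j} + W − (k^d − 1)·(Ψ∅)_{∅∅}·1`. [cite: BratteliKishimotoRobinson1978, §3 (H̃_Φ(Λ), W_Φ(Λ), p. 47)] -/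
theorem localHamiltonian_box_eq_decoupled_add_straddling_sub (Ψ : FermionInteraction d) (hm : 1 ≤ m) (k : ℕ) :
    Ψ.localHamiltonian (halfOpenBox d (k * m)) =
      (∑ j : halfOpenBox d k, fermionEmbed
          (PolySite.incl (InfVolFermionState.shiftSet_smul_halfOpenBox_subset (le_refl (k * m)) j.2))
          (Ψ.localHamiltonian (shiftSet ((m : ℤ) • (j : Site d)) (halfOpenBox d m)))) +
        (∑ Y ∈ (halfOpenBox d (k * m)).powerset with
            (Y ≠ ∅ ∧ ∀ j : halfOpenBox d k, ¬ Y ⊆ shiftSet ((m : ℤ) • (j : Site d)) (halfOpenBox d m)),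
          (if h : Y ⊆ halfOpenBox d (k * m) then fermionEmbed (PolySite.incl h) (Ψ.Φ Y) else 0)) -
        (((Fintype.card (halfOpenBox d k) : ℂ) - 1) * ((Ψ.Φ ∅) ∅ ∅)) • (1 : FermionOp (halfOpenBox d (k * m))) := by
  have hsplit := sum_powerset_eq_empty_add_parts_add_straddling (halfOpenBox d (k * m))
    (fun j : halfOpenBox d k => shiftSet ((m : ℤ) • (j : Site d)) (halfOpenBox d m))
    (fun j => InfVolFermionState.shiftSet_smul_halfOpenBox_subset (le_refl (k * m)) j.2)
    (fun j j' hjj' => InfVolFermionState.disjoint_shiftSet_smul_halfOpenBox hm fun h => hjj' (Subtype.ext h))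
    (fun Y => if h : Y ⊆ halfOpenBox d (k * m) then fermionEmbed (PolySite.incl h) (Ψ.Φ Y) else 0)
  rw [Ψ.localHamiltonian_eq_sum (halfOpenBox d (k * m)), hsplit]
  simp only [dif_pos (Finset.empty_subset (halfOpenBox d (k * m)))]
  rw [Ψ.fermionEmbed_apply_empty (Finset.empty_subset (halfOpenBox d (k * m)))]
  rw [Finset.sum_congr rfl fun (j : halfOpenBox d k) _ =>
    congrArg (fun A => A - ((Ψ.Φ ∅) ∅ ∅) • (1 : FermionOp (halfOpenBox d (k * m))))
      (Ψ.sum_powerset_subregion_eq (InfVolFermionState.shiftSet_smul_halfOpenBox_subset (le_refl (k * m)) j.2))]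
  rw [Finset.sum_sub_distrib, Finset.sum_const, Finset.card_univ, ← Nat.cast_smul_eq_nsmul ℂ, smul_smul]
  have e : (((Fintype.card (halfOpenBox d k) : ℂ) - 1) * ((Ψ.Φ ∅) ∅ ∅)) • (1 : FermionOp (halfOpenBox d (k * m))) =
      ((Fintype.card (halfOpenBox d k) : ℂ) * ((Ψ.Φ ∅) ∅ ∅)) • (1 : FermionOp (halfOpenBox d (k * m))) -
        ((Ψ.Φ ∅) ∅ ∅) • (1 : FermionOp (halfOpenBox d (k * m))) := by
    rw [sub_mul, one_mul, sub_smul]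
  rw [e]
  abel

/-- **THE STRADDLING TERMS ARE A SURFACE EFFECT**: `‖W‖ ≤ k^d · |thicken_R([0,m)^d) ∖ [0,m)^d| · S_Ψ` for a translation-covariant `Ψ` of
finite range `R` (every straddling `Y` carrying a term meets some sub-box, is not inside it, and lies in its `R`-neighbourhood).
[cite: BratteliKishimotoRobinson1978, §3 (W_Φ(Λ), p. 47) and Thm. 2 (proof, p. 48)] -/
theorem norm_straddling_le (hT : Ψ.IsTranslationInvariant) (hR : Ψ.HasFiniteRange R) (hm : 1 ≤ m) (k : ℕ) :
    ‖∑ Y ∈ (halfOpenBox d (k * m)).powerset with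
          (Y ≠ ∅ ∧ ∀ j : halfOpenBox d k, ¬ Y ⊆ shiftSet ((m : ℤ) • (j : Site d)) (halfOpenBox d m)),
        (if h : Y ⊆ halfOpenBox d (k * m) then fermionEmbed (PolySite.incl h) (Ψ.Φ Y) else 0)‖ ≤
      (Fintype.card (halfOpenBox d k) : ℝ) * (((thicken (halfOpenBox d m) R \ halfOpenBox d m).card : ℝ) *
        ∑ X ∈ (thicken ({0} : Finset (Site d)) R).powerset with (0 : Site d) ∈ X, ‖Ψ.Φ X‖) := by
  classical
  set B : halfOpenBox d k → Finset (Site d) := fun j => shiftSet ((m : ℤ) • (j : Site d)) (halfOpenBox d m) with hB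
  set S := (halfOpenBox d (k * m)).powerset.filter fun Y => Y ≠ ∅ ∧ ∀ j : halfOpenBox d k, ¬ Y ⊆ B j with hS
  -- norms of the embedded terms
  refine (norm_sum_le _ _).trans ?_
  have h1 : ∑ Y ∈ S, ‖(if h : Y ⊆ halfOpenBox d (k * m) then fermionEmbed (PolySite.incl h) (Ψ.Φ Y) else 0)‖ ≤
      ∑ Y ∈ S, ‖Ψ.Φ Y‖ :=
    Finset.sum_le_sum fun Y hY => by
      rw [hS, Finset.mem_filter, Finset.mem_powerset] at hY
      rw [dif_pos hY.1]
      exact norm_fermionEmbed_le _ _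
  refine h1.trans ?_
  -- drop the terms with `Φ Y = 0`, cover the rest by the collars of the sub-boxes
  have h2 : ∑ Y ∈ S.filter (fun Y => Ψ.Φ Y ≠ 0), ‖Ψ.Φ Y‖ = ∑ Y ∈ S, ‖Ψ.Φ Y‖ :=
    Finset.sum_filter_of_ne fun Y _ hY h0 => by rw [h0, norm_zero] at hY; exact hY rfl
  rw [← h2]
  have hcover : S.filter (fun Y => Ψ.Φ Y ≠ 0) ⊆
      Finset.univ.biUnion fun j : halfOpenBox d k => (thicken (B j) R).powerset.filter fun Y => ¬ Y ⊆ B j := by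
    intro Y hY
    rw [Finset.mem_filter, hS, Finset.mem_filter, Finset.mem_powerset] at hY
    obtain ⟨⟨hYΛ, hYne, hYout⟩, hΦ⟩ := hY
    obtain ⟨y, hy⟩ := Finset.nonempty_iff_ne_empty.2 hYne
    obtain ⟨j, hj, hyj⟩ := exists_mem_subBox hm (hYΛ hy)
    refine Finset.mem_biUnion.2 ⟨⟨j, hj⟩, Finset.mem_univ _, Finset.mem_filter.2 ⟨Finset.mem_powerset.2 ?_, hYout ⟨j, hj⟩⟩⟩
    exact (hR.subset_thicken_singleton hΦ hy).trans (thicken_subset_thicken_of_subset (Finset.singleton_subset_iff.2 hyj) R)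
  refine (sum_le_sum_sum_of_subset_biUnion _ hcover fun _ => norm_nonneg _).trans ?_
  have h3 : ∀ j : halfOpenBox d k, ∑ Y ∈ (thicken (B j) R).powerset.filter (fun Y => ¬ Y ⊆ B j), ‖Ψ.Φ Y‖ ≤
      ((thicken (halfOpenBox d m) R \ halfOpenBox d m).card : ℝ) *
        ∑ X ∈ (thicken ({0} : Finset (Site d)) R).powerset with (0 : Site d) ∈ X, ‖Ψ.Φ X‖ := by
    intro j
    have h := hT.sum_filter_not_subset_norm_le hR (B j)
    rw [hB, card_thicken_shiftSet_sdiff] at h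
    exact h
  refine (Finset.sum_le_sum fun j _ => h3 j).trans ?_
  rw [Finset.sum_const, Finset.card_univ, nsmul_eq_mul]

/-! ### §3 The partition function of the tiled box -/

/-- **`log Z` OF A BOX TILED BY SUB-BOXES** (`Ψ` Hermitian, even, translation covariant, finite range `R`; `m ≥ 1`, `β ≥ 0`):
`|log Re Z_{[0,km)^d} − k^d·log Re Z_{[0,m)^d} − β(k^d − 1)·Re(Ψ∅)_{∅∅}| ≤ β · k^d · |thicken_R([0,m)^d) ∖ [0,m)^d| · S_Ψ`.
[cite: BratteliRobinsonII1997, §6.2.4 (Prop. 6.2.39 ff.)] [cite: BratteliKishimotoRobinson1978, Thm. 2 (proof, p. 48)] -/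
theorem abs_log_partitionFn_box_sub_le (hH : Ψ.IsHermitian) (hE : Ψ.IsEven) (hT : Ψ.IsTranslationInvariant)
    (hR : Ψ.HasFiniteRange R) (hm : 1 ≤ m) (k : ℕ) {β : ℝ} (hβ : 0 ≤ β) :
    |Real.log (Matrix.partitionFn β (Ψ.localHamiltonian (halfOpenBox d (k * m)))).re -
        (k : ℝ) ^ d * Real.log (Matrix.partitionFn β (Ψ.localHamiltonian (halfOpenBox d m))).re -
        β * (((k : ℝ) ^ d - 1) * ((Ψ.Φ ∅) ∅ ∅).re)| ≤
      β * ((k : ℝ) ^ d * (((thicken (halfOpenBox d m) R \ halfOpenBox d m).card : ℝ) *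
        ∑ X ∈ (thicken ({0} : Finset (Site d)) R).powerset with (0 : Site d) ∈ X, ‖Ψ.Φ X‖)) := by
  classical
  haveI : Nonempty (Finset (Orb (PolySite (halfOpenBox d (k * m))))) := ⟨∅⟩
  have hdecomp := Ψ.localHamiltonian_box_eq_decoupled_add_straddling_sub hm k
  have hWn := norm_straddling_le hT hR hm k
  set D : FermionOp (halfOpenBox d (k * m)) := ∑ j : halfOpenBox d k, fermionEmbed
      (PolySite.incl (InfVolFermionState.shiftSet_smul_halfOpenBox_subset (le_refl (k * m)) j.2))
      (Ψ.localHamiltonian (shiftSet ((m : ℤ) • (j : Site d)) (halfOpenBox d m))) with hD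
  set W : FermionOp (halfOpenBox d (k * m)) := ∑ Y ∈ (halfOpenBox d (k * m)).powerset with
      (Y ≠ ∅ ∧ ∀ j : halfOpenBox d k, ¬ Y ⊆ shiftSet ((m : ℤ) • (j : Site d)) (halfOpenBox d m)),
      (if h : Y ⊆ halfOpenBox d (k * m) then fermionEmbed (PolySite.incl h) (Ψ.Φ Y) else 0) with hW
  set c : ℝ := ((Ψ.Φ ∅) ∅ ∅).re with hc
  have hcreal : ((Ψ.Φ ∅) ∅ ∅) = (c : ℂ) := by
    have h := (hH ∅).apply ∅ ∅
    refine Complex.ext (by rw [hc, Complex.ofReal_re]) ?_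
    have him := congrArg Complex.im h
    simp only [Complex.star_def, Complex.conj_im] at him
    rw [Complex.ofReal_im]
    linarith
  have hK : (Fintype.card (halfOpenBox d k) : ℝ) = (k : ℝ) ^ d := by
    rw [Fintype.card_coe, card_halfOpenBox]; push_cast; ring
  -- Hermitian pieces
  have hDh : D.IsHermitian := by
    rw [hD]
    unfold Matrix.IsHermitian
    rw [Matrix.conjTranspose_sum]
    exact Finset.sum_congr rfl fun j _ => by
      rw [← fermionEmbed_conjTranspose, (localHamiltonian_isHermitian hH _).eq]
  have hWh : W.IsHermitian := by
    rw [hW]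
    unfold Matrix.IsHermitian
    rw [Matrix.conjTranspose_sum]
    refine Finset.sum_congr rfl fun Y hY => ?_
    rw [Finset.mem_filter, Finset.mem_powerset] at hY
    rw [dif_pos hY.1, ← fermionEmbed_conjTranspose, (hH Y).eq]
  -- `log Z(H) = log Z(D + W) + β (k^d - 1) c`
  have hHDW : Ψ.localHamiltonian (halfOpenBox d (k * m)) =
      (D + W) + (((-(((Fintype.card (halfOpenBox d k) : ℝ)) - 1) * c) : ℝ) : ℂ) • (1 : FermionOp (halfOpenBox d (k * m))) := by
    rw [hdecomp, hcreal, sub_eq_add_neg, ← neg_smul]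
    congr 2
    push_cast
    ring
  have hlogH : Real.log (Matrix.partitionFn β (Ψ.localHamiltonian (halfOpenBox d (k * m)))).re =
      Real.log (Matrix.partitionFn β (D + W)).re + β * ((((Fintype.card (halfOpenBox d k) : ℝ)) - 1) * c) := by
    rw [hHDW, log_partitionFn_add_smul_one (hDh.add hWh) β]
    ring
  -- `|log Z(D + W) − log Z(D)| ≤ β ‖W‖`
  have hLip := abs_log_partitionFn_sub_log_partitionFn_le (hDh.add hWh) hDh hβ
  rw [add_sub_cancel_left] at hLip
  -- `log Z(D) = k^d log Z_m`
  have hlogD : Real.log (Matrix.partitionFn β D).re =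
      (Fintype.card (halfOpenBox d k) : ℝ) * Real.log (Matrix.partitionFn β (Ψ.localHamiltonian (halfOpenBox d m))).re := by
    rw [hD]
    exact log_partitionFn_decoupledSum_translates hT hH hE
      (fun j : halfOpenBox d k => InfVolFermionState.shiftSet_smul_halfOpenBox_subset (le_refl (k * m)) j.2)
      (fun j j' hjj' => InfVolFermionState.disjoint_shiftSet_smul_halfOpenBox hm fun h => hjj' (Subtype.ext h))
      (by rw [card_halfOpenBox, Fintype.card_coe, card_halfOpenBox, card_halfOpenBox, mul_pow, mul_comm]) β
  rw [hK] at hlogH hlogD hWn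
  rw [hlogH]
  have e : Real.log (Matrix.partitionFn β (D + W)).re + β * (((k : ℝ) ^ d - 1) * c) -
      (k : ℝ) ^ d * Real.log (Matrix.partitionFn β (Ψ.localHamiltonian (halfOpenBox d m))).re - β * (((k : ℝ) ^ d - 1) * c) =
      Real.log (Matrix.partitionFn β (D + W)).re - Real.log (Matrix.partitionFn β D).re := by
    rw [hlogD]; ring
  rw [e]
  exact hLip.trans (mul_le_mul_of_nonneg_left hWn hβ)

end FermionInteraction

end Literature.MathematicalPhysics.QuantumLattice

end
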